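import Summits.ABC.IUTFork.LDHGenuineHullRegimeSlack
import HarnessLib

/-!
# The fork at [IUTchIII] Corollary 3.12, L-DH level, READING (U): the per-point content of the (U)-line crux `stub_cor312` —
# `Cor312AtDatum P l` implies the PNT-free Szpiro-type bound UP TO THE SLOT RESIDUE (abc-iut cell, crux ThetaPartII = stmt-ABC-19678)

Record-only PROOF file (D-0012) of the abc-iut cell (WAVE-3 discharge seat abc-iut-c312-d1, gen 6); TAKES NO SIDE on [IUTchIII]
Cor. 3.12 or on the (U)/(P) readings, asserts nothing about any point. (U)-twin of this seat's `LDHGenuinePerImageContentful` ((P) line):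
the same PNT-free constant `B_#(P,l) := (l+1)/4·{(1+4/l)·(L + 2·log l + 21) + (4/l)·(2·d_mod·L + log(30·l)) + (20/3)·log(d*·l)·(2·d_mod·L +
log(30·l))/log 2}` (`L := log-diff + log 𝔣^{∤{2,l}}`; the Step (viii) count bounded by the number of support primes, abc-iut-S3, instead of by
`π(d*·l)`), now in reading (U), where the (Ind1) slot residue `slotResidue(T)` (abc-iut-c312-d1 `DHData.hullEstimateOf_ofInput_min_explicit`,
abc-iut-S8 `PilotSlotResidue`) rides along:

* `PointDict.hullEstimateOf_countForm_add_slotResidue` — `T.HullEstimateOf (B_#(P,l) + slotResidue(T))`, EVERY datum, no hypothesis;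
* **`PointDict.szpiro_sub_slotResidue_of_cor312AtDatum`** — `Cor22.Cor312AtDatum P l →`
  `((l+1)/24 − 1/(2l))·log q^{∤{2,l}}(λ) − slotResidue(T) ≤ B_#(P,l) + ((l+5)/4)·log π`;
* `PointDict.szpiro_of_cor312AtDatum_of_slotConstant` — at SLOT-CONSTANT data (e.g. `d_mod = 1`, abc-iut-S2
  `slotResidue_eq_zero_of_dmod_eq_one`) the residue vanishes and the (U)-crux has the same contentful Szpiro-type content as the (P)-crux;
  `PointDict.szpiro_of_cor312AtDatum_of_dmod_eq_one`.

READING: since `slotResidue(T) ≤ ((l+1)/24)·log q^{∤{2,l}}(λ)` (this seat's `slotResidue_le_logQAvoid`) can be as large as the whole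
left-hand side (abc-iut-s2-p2 `slotResidue_ge_mixedShare`: at fully mixed support primes it IS the whole `p`-part), the (U)-crux's per-point
content ranges from «Szpiro with the PNT-free constant» (slot-constant data) to NOTHING (fully mixed data — where abc-iut-s2-p4/c312-3 show the
(U)-Corollary is even a theorem: `cor312AtDatum_of_badMass_le_half`); the (P)-crux always has the full content (`szpiro_of_cor312PerImageAtDatum`).
[cite: Mochizuki2012, IUTchIV Thm. 1.10 proof Steps (ii)–(viii) p. 24–30] [cite: DupuyHilado2025, §4.7, §4.11–4.12]
[claim: Mochizuki2012, status: disputed] for every IUT quotation. PROOF-ONLY: no definitions, no new `Prop`.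
-/

noncomputable section

namespace Summit.ABC.IUTFork

open Literature.IUT.HodgeTheaters Literature.IUT.LogVolume NumberField IsDedekindDomain
open Literature.NumberTheory.DiophantineGeometry.GenEll
open scoped Nat.Prime

namespace PointDict

variable {P : NFPoint} {l : ℕ}

/-- `log((2^12·3^3·5·d)·l) ≥ 0` for `d, l ≥ 1`. [cite: Mochizuki2012, IUTchIV Thm. 1.10 p. 22] -/
private theorem log_dstar_mul_nonneg₆ {d l : ℕ} (hd : 1 ≤ d) (hl : 1 ≤ l) :
    0 ≤ Real.log (((2 ^ 12 * 3 ^ 3 * 5 * d : ℕ) : ℝ) * l) := by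
  apply Real.log_nonneg
  have h1 : (1 : ℝ) ≤ ((2 ^ 12 * 3 ^ 3 * 5 * d : ℕ) : ℝ) := by exact_mod_cast (by nlinarith : 1 ≤ 2 ^ 12 * 3 ^ 3 * 5 * d)
  have h2 : (1 : ℝ) ≤ (l : ℝ) := by exact_mod_cast hl
  nlinarith

/-- **Reading (U), every datum: `T.HullEstimateOf (B_#(P,l) + slotResidue(T))`** — abc-iut-c312-d1's `λ_min` Step (v) estimate
(`DHData.hullEstimateOf_ofInput_min_explicit`, (R4) by abc-iut-S1's tower fact) with the pinned Step (ii)/(iii) bounds and the support-prime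
COUNT in place of `π(d*·l)`. No hypothesis. [cite: Mochizuki2012, IUTchIV Thm. 1.10 proof Steps (ii)–(viii) p. 24–30]
[claim: Mochizuki2012, status: disputed] -/
theorem hullEstimateOf_countForm_add_slotResidue (T : Cor22.ThetaVolumeDatumAt P l) (hP : P ∈ UP) (h7 : 7 ≤ l) :
    T.HullEstimateOf (((l : ℝ) + 1) / 4 *
      ((1 + 4 / (l : ℝ)) * (P.logDiff + Cor22.logCondAvoid P {2, l} + 2 * Real.log l + 21)
        + 4 / (l : ℝ) * (2 * (Cor22.dmod P : ℝ) * (P.logDiff + Cor22.logCondAvoid P {2, l}) + Real.log (2 * 3 * 5 * (l : ℝ)))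
        + 20 / 3 * Real.log (((2 ^ 12 * 3 ^ 3 * 5 * Cor22.dmod P : ℕ) : ℝ) * l)
          * ((2 * (Cor22.dmod P : ℝ) * (P.logDiff + Cor22.logCondAvoid P {2, l}) + Real.log (2 * 3 * 5 * (l : ℝ)))
              / Real.log 2))
      + (letI := T.instFieldF; letI := T.instNumberFieldF; letI := T.instFieldK; letI := T.instNumberFieldK
         letI := T.instAlgebraK
         T.I.X.slotResidue T.I.supportPrimes)) := by
  classical
  letI := T.instFieldF; letI := T.instNumberFieldF; letI := T.instAlgebraF; letI := T.instFieldK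
  letI := T.instNumberFieldK; letI := T.instAlgebraK; letI := T.instFieldFbar; letI := T.instAlgebraFbar
  letI := T.instAlgebraKFbar; letI := T.instIsElliptic
  have hU : P.InU := hP.1
  have hl1 : 1 ≤ l := by omega
  have hd : 1 ≤ Cor22.dmod P := Cor22.dmod_pos P
  have hXl : ((T.I.X.l : ℕ) : ℝ) = (l : ℝ) := by exact_mod_cast T.isVolumeInputOf.l_eq
  haveI : IsGalois (fieldOfModuli T.E) T.K := T.isGalois_fieldOfModuli_K
  have hprimes : ∀ p ∈ T.I.supportPrimes, p.Prime := fun p hp => T.I.prime_of_mem_supportPrimes hp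
  have hlmod := log_dstar_mul_nonneg₆ hd hl1
  have h0 := DHData.hullEstimateOf_ofInput_min_explicit T.I (2 ^ 12 * 3 ^ 3 * 5 * Cor22.dmod P * l) hlmod
    (T.R4_towerFact hP)
  rw [hXl] at h0
  have hA1 := sum_dite_localDegree_mul_differentOrd_le_ndeg (fieldOfModuli T.E) T.K T.I.σ T.I.supportPrimes hprimes
  have hA2 := T.ndeg_differentDivisor_le hU h7
  have hA : (∑ p ∈ T.I.supportPrimes, if hp : p.Prime then haveI : Fact p.Prime := ⟨hp⟩
        (∑ v : placesOver (fieldOfModuli T.E) p, (localDegree (fieldOfModuli T.E) v.1 : ℝ) *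
          differentOrd p ((T.I.σ.localFieldFamily p hp).k v)) / Module.finrank ℚ (fieldOfModuli T.E) * Real.log p
        else 0) ≤ P.logDiff + Cor22.logCondAvoid P {2, l} + 2 * Real.log l + 21 := hA1.trans hA2
  have hB := T.sum_log_supportPrimes_le_pinned hP
  have hcnt := card_supportPrimes_filter_le T hP (2 ^ 12 * 3 ^ 3 * 5 * Cor22.dmod P * l)
  refine T.hullEstimateOf_mono h0 ?_
  have hc0 : (0 : ℝ) ≤ ((l : ℝ) + 1) / 4 := by positivity
  have hl0 : (0 : ℝ) < l := by exact_mod_cast (lt_of_lt_of_le (by norm_num) h7)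
  have hc1 : (0 : ℝ) ≤ 1 + 4 / (l : ℝ) := by positivity
  have hc2 : (0 : ℝ) ≤ 4 / (l : ℝ) := by positivity
  have hc3 : (0 : ℝ) ≤ 20 / 3 * Real.log (((2 ^ 12 * 3 ^ 3 * 5 * Cor22.dmod P : ℕ) : ℝ) * l) := by positivity
  have t1 := mul_le_mul_of_nonneg_left hA hc1
  have t2 := mul_le_mul_of_nonneg_left hB hc2
  have t3 := mul_le_mul_of_nonneg_left hcnt hc3
  have t4 : ((l : ℝ) + 1) / 4 * ((1 + 4 / (l : ℝ)) *
          (∑ p ∈ T.I.supportPrimes, if hp : p.Prime then haveI : Fact p.Prime := ⟨hp⟩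
            (∑ v : placesOver (fieldOfModuli T.E) p, (localDegree (fieldOfModuli T.E) v.1 : ℝ) *
              differentOrd p ((T.I.σ.localFieldFamily p hp).k v)) / Module.finrank ℚ (fieldOfModuli T.E) * Real.log p else 0)
        + 4 / (l : ℝ) * (∑ p ∈ T.I.supportPrimes, Real.log p)
        + 20 / 3 * Real.log (((2 ^ 12 * 3 ^ 3 * 5 * Cor22.dmod P : ℕ) : ℝ) * l)
          * ((T.I.supportPrimes.filter (· ≤ 2 ^ 12 * 3 ^ 3 * 5 * Cor22.dmod P * l)).card : ℝ)) ≤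
      ((l : ℝ) + 1) / 4 *
      ((1 + 4 / (l : ℝ)) * (P.logDiff + Cor22.logCondAvoid P {2, l} + 2 * Real.log l + 21)
        + 4 / (l : ℝ) * (2 * (Cor22.dmod P : ℝ) * (P.logDiff + Cor22.logCondAvoid P {2, l}) + Real.log (2 * 3 * 5 * (l : ℝ)))
        + 20 / 3 * Real.log (((2 ^ 12 * 3 ^ 3 * 5 * Cor22.dmod P : ℕ) : ℝ) * l)
          * ((2 * (Cor22.dmod P : ℝ) * (P.logDiff + Cor22.logCondAvoid P {2, l}) + Real.log (2 * 3 * 5 * (l : ℝ)))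
              / Real.log 2)) :=
    mul_le_mul_of_nonneg_left (by linarith) hc0
  linarith

/-- **THE (U)-LINE CRUX PER POINT, UP TO THE SLOT RESIDUE**: for an admissible `(P, l)` (`λ ∈ U_P`, `l ≥ 7`) carrying a datum `T`,
`Cor22.Cor312AtDatum P l` (reading (U); HYPOTHESIS — the disputed crux) implies
`((l+1)/24 − 1/(2l))·log q^{∤{2,l}}(λ) − slotResidue(T) ≤ B_#(P,l) + ((l+5)/4)·log π`.
[cite: Mochizuki2012, IUTchIV Thm. 1.10 proof Steps (v)–(x) p. 27–32] [claim: Mochizuki2012, status: disputed] -/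
theorem szpiro_sub_slotResidue_of_cor312AtDatum (hP : P ∈ UP) (h7 : 7 ≤ l) (h : Cor22.Cor312AtDatum P l)
    (T : Cor22.ThetaVolumeDatumAt P l) :
    (((l : ℝ) + 1) / 24 - 1 / (2 * l)) * Cor22.logQAvoid P {2, l}
      - (letI := T.instFieldF; letI := T.instNumberFieldF; letI := T.instFieldK; letI := T.instNumberFieldK
         letI := T.instAlgebraK
         T.I.X.slotResidue T.I.supportPrimes) ≤
      ((l : ℝ) + 1) / 4 *
        ((1 + 4 / (l : ℝ)) * (P.logDiff + Cor22.logCondAvoid P {2, l} + 2 * Real.log l + 21)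
          + 4 / (l : ℝ) * (2 * (Cor22.dmod P : ℝ) * (P.logDiff + Cor22.logCondAvoid P {2, l}) + Real.log (2 * 3 * 5 * (l : ℝ)))
          + 20 / 3 * Real.log (((2 ^ 12 * 3 ^ 3 * 5 * Cor22.dmod P : ℕ) : ℝ) * l)
            * ((2 * (Cor22.dmod P : ℝ) * (P.logDiff + Cor22.logCondAvoid P {2, l}) + Real.log (2 * 3 * 5 * (l : ℝ)))
                / Real.log 2))
      + ThetaVolumeInput.archLogTheta l := by
  have hsq := T.gap_le (h T) (hullEstimateOf_countForm_add_slotResidue T hP h7)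
  rw [gap_eq T hP.1] at hsq
  linarith

/-- **SLOT-CONSTANT DATA: the (U)-crux has the same per-point content as the (P)-crux.** If every support prime of the datum is
slot-constant (the gain `θ_j` is constant on `V(F_mod)_p`: abc-iut-S8 `PilotData.slotResidue_eq_zero_of_const`), then `Cor22.Cor312AtDatum P l`
implies `((l+1)/24 − 1/(2l))·log q^{∤{2,l}}(λ) ≤ B_#(P,l) + ((l+5)/4)·log π`.
[cite: Mochizuki2012, IUTchIV Thm. 1.10 proof Step (v) p. 28] [claim: Mochizuki2012, status: disputed] -/
theorem szpiro_of_cor312AtDatum_of_slotConstant (hP : P ∈ UP) (h7 : 7 ≤ l) (h : Cor22.Cor312AtDatum P l)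
    (T : Cor22.ThetaVolumeDatumAt P l)
    (hconst : letI := T.instFieldF; letI := T.instNumberFieldF; letI := T.instFieldK; letI := T.instNumberFieldK
      letI := T.instAlgebraK; letI := T.instIsElliptic
      ∀ p ∈ T.I.supportPrimes, ∀ (i : Fin T.I.X.lstar) (v w : placesOver (fieldOfModuli T.E) p),
        T.I.X.slotValue i v.1 = T.I.X.slotValue i w.1) :
    (((l : ℝ) + 1) / 24 - 1 / (2 * l)) * Cor22.logQAvoid P {2, l} ≤
      ((l : ℝ) + 1) / 4 *
        ((1 + 4 / (l : ℝ)) * (P.logDiff + Cor22.logCondAvoid P {2, l} + 2 * Real.log l + 21)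
          + 4 / (l : ℝ) * (2 * (Cor22.dmod P : ℝ) * (P.logDiff + Cor22.logCondAvoid P {2, l}) + Real.log (2 * 3 * 5 * (l : ℝ)))
          + 20 / 3 * Real.log (((2 ^ 12 * 3 ^ 3 * 5 * Cor22.dmod P : ℕ) : ℝ) * l)
            * ((2 * (Cor22.dmod P : ℝ) * (P.logDiff + Cor22.logCondAvoid P {2, l}) + Real.log (2 * 3 * 5 * (l : ℝ)))
                / Real.log 2))
      + ThetaVolumeInput.archLogTheta l := by
  letI := T.instFieldF; letI := T.instNumberFieldF; letI := T.instAlgebraF; letI := T.instFieldK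
  letI := T.instNumberFieldK; letI := T.instAlgebraK; letI := T.instIsElliptic
  have hmain := szpiro_sub_slotResidue_of_cor312AtDatum hP h7 h T
  have hzero : T.I.X.slotResidue T.I.supportPrimes = 0 := T.I.X.slotResidue_eq_zero_of_const _ hconst
  rw [hzero] at hmain
  linarith

/-- **DEGREE-ONE POINTS (`d_mod = 1`): the (U)-crux per point = the PNT-free Szpiro-type bound** (the residue vanishes:
abc-iut-S2/S8 `PointStepV.slotResidue_eq_zero_of_dmod_eq_one`). [cite: Mochizuki2012, IUTchIV Thm. 1.10 proof Step (v) p. 28]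
[claim: Mochizuki2012, status: disputed] -/
theorem szpiro_of_cor312AtDatum_of_dmod_eq_one (hP : P ∈ UP) (h7 : 7 ≤ l) (hd : Cor22.dmod P = 1)
    (h : Cor22.Cor312AtDatum P l) (T : Cor22.ThetaVolumeDatumAt P l) :
    (((l : ℝ) + 1) / 24 - 1 / (2 * l)) * Cor22.logQAvoid P {2, l} ≤
      ((l : ℝ) + 1) / 4 *
        ((1 + 4 / (l : ℝ)) * (P.logDiff + Cor22.logCondAvoid P {2, l} + 2 * Real.log l + 21)
          + 4 / (l : ℝ) * (2 * (Cor22.dmod P : ℝ) * (P.logDiff + Cor22.logCondAvoid P {2, l}) + Real.log (2 * 3 * 5 * (l : ℝ)))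
          + 20 / 3 * Real.log (((2 ^ 12 * 3 ^ 3 * 5 * Cor22.dmod P : ℕ) : ℝ) * l)
            * ((2 * (Cor22.dmod P : ℝ) * (P.logDiff + Cor22.logCondAvoid P {2, l}) + Real.log (2 * 3 * 5 * (l : ℝ)))
                / Real.log 2))
      + ThetaVolumeInput.archLogTheta l := by
  letI := T.instFieldF; letI := T.instNumberFieldF; letI := T.instAlgebraF; letI := T.instFieldK
  letI := T.instNumberFieldK; letI := T.instAlgebraK; letI := T.instIsElliptic
  have hmain := szpiro_sub_slotResidue_of_cor312AtDatum hP h7 h T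
  have hzero := PointStepV.slotResidue_eq_zero_of_dmod_eq_one T hd
  rw [hzero] at hmain
  linarith

end PointDict

end Summit.ABC.IUTFork

end
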